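import Summits.RiemannHypothesis.RiemannHypothesis.Theorems.JensenPolynomialsFarGumbelPhase
import Mathlib.Analysis.Complex.ExponentialBounds

/-!
# Route `JensenPolynomials`, FAR crux `XiWindowZeroFreeRelFar` (B1-rel far) — S3 WANTED item (L3), part 2a: the
POINTWISE BOUND for the real part of the far phase along a horizontal shift, and the one-variable facts
(RH-FREE; cell rh-jensen, HUMAN RULING D-0040)

Item `stmt-RiemannHypothesis-19465`, stub S3 `stub_laplaceFar`, WANTED list v3 (HOME `eng-4/S3/S3-WANTED.lean`, sha16
`d6f8107cd04d985a`), item (L3) `wanted_descent` (file `JensenPolynomialsFarGumbelDescent.lean`). Generic inputs: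

* `re_farPsi_shift_sub_le`: `Re Ψ(u) = log 2π² + 9Re u − Re(πe^{4u}) + log‖u‖ + (M−½)log‖u²+a‖` (`Complex.log_re`) and
  `Re(πe^{4(u_s+t)}) = e^{4t}·Re(πe^{4u_s})`; two uses of `log x ≤ x − 1` give, for every real `t`,
  `Re Ψ(u_s+t) − Re Ψ(u_s) ≤ −P(e^{4t} − 1 − 4t) + t(9 − 4P + Re((2M−1)u_s/q)) + |t|/‖u_s‖ + t²(M−½)/‖q‖
   + t²‖2u_s+t‖²(M−½)/(2‖q‖²)` (`P = Re(πe^{4u_s})`, `q = u_s² + a`; `Ψ = farPsi M a`);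
* `descent_left_aux`: `e^{−4s} − 1 + 4s − (9/200)s − (103/100)s² ≥ 29/10000` on `[1/30, 213/100]`;
  `descent_right_aux`: `e^{4t} − 1 − 4t − (9/200)t − t²/4 − (39/50)t²(1+t/18)² ≥ (697/100)t² − (9/200)t` for `t ≥ 0`;
* `norm_two_mul_add_sq_le_left/right`, `line_ne_zero`: sizes of `‖2u_s + t‖²` and non-vanishing on the line.

WHAT THIS IS NOT: inequalities about explicit elementary functions; nothing here bears on the zeros of `ζ` or RH.
-/

noncomputable section
-- D-0017: `Summit.RiemannHypothesis.RiemannHypothesis.…` duplicates the namespace BY DESIGN (single-problem summit).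
set_option linter.dupNamespace false

namespace Summit.RiemannHypothesis.RiemannHypothesis.Theorems.JensenPolynomials.FarGumbel

open Complex
open scoped Real

/-! ## 1. The pointwise bound along a horizontal shift -/

/-- **POINTWISE BOUND.** For `u_s ≠ 0`, `q = u_s² + a ≠ 0`, real `t` with `u_s + t ≠ 0`, `(u_s+t)² + a ≠ 0`, and `M ≥ ½`:
`Re Ψ(u_s+t) − Re Ψ(u_s) ≤ −P(e^{4t} − 1 − 4t) + t(9 − 4P + Re((2M−1)u_s/q)) + |t|/‖u_s‖ + t²(M−½)/‖q‖
 + t²‖2u_s+t‖²(M−½)/(2‖q‖²)`, `P = Re(πe^{4u_s})` (from `Re Log = log‖·‖` and `log x ≤ x − 1` twice). -/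
theorem re_farPsi_shift_sub_le (M : ℕ) (a u_s : ℂ) (t : ℝ) (hT0 : 0 ≤ (M : ℝ) - 1 / 2)
    (hu0 : u_s ≠ 0) (hq0 : u_s ^ 2 + a ≠ 0) (hut : u_s + t ≠ 0) (hqt : (u_s + t) ^ 2 + a ≠ 0) :
    (farPsi M a (u_s + t)).re - (farPsi M a u_s).re ≤
      -(((π : ℂ) * Complex.exp (4 * u_s)).re * (Real.exp (4 * t) - 1 - 4 * t))
      + t * (9 - 4 * ((π : ℂ) * Complex.exp (4 * u_s)).re + ((2 * (M : ℂ) - 1) * u_s / (u_s ^ 2 + a)).re)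
      + |t| / ‖u_s‖ + t ^ 2 * (((M : ℝ) - 1 / 2) / ‖u_s ^ 2 + a‖)
      + t ^ 2 * ‖2 * u_s + t‖ ^ 2 * (((M : ℝ) - 1 / 2) / (2 * ‖u_s ^ 2 + a‖ ^ 2)) := by
  set Pc : ℂ := (π : ℂ) * Complex.exp (4 * u_s) with hPc
  set q : ℂ := u_s ^ 2 + a with hqdef
  set T : ℝ := (M : ℝ) - 1 / 2 with hTdef
  have hTC : ((M : ℂ) - 1 / 2) = (T : ℂ) := by rw [hTdef]; push_cast; ring
  have h2M : (2 * (M : ℂ) - 1) = ((2 * T : ℝ) : ℂ) := by rw [hTdef]; push_cast; ring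
  have hq' : 0 < ‖q‖ := norm_pos_iff.mpr hq0
  -- the exponential factor along the shift
  have h4 : (π : ℂ) * Complex.exp (4 * (u_s + t)) = ((Real.exp (4 * t) : ℝ) : ℂ) * Pc := by
    rw [hPc, mul_add, Complex.exp_add, Complex.ofReal_exp]
    push_cast
    ring
  -- the `log ‖u‖` term
  have hlog1 : Real.log ‖u_s + t‖ - Real.log ‖u_s‖ ≤ |t| / ‖u_s‖ := by
    have h0 : 0 < ‖u_s‖ := norm_pos_iff.mpr hu0
    have h1 : 0 < ‖u_s + t‖ := norm_pos_iff.mpr hut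
    rw [← Real.log_div h1.ne' h0.ne']
    calc Real.log (‖u_s + ↑t‖ / ‖u_s‖) ≤ ‖u_s + ↑t‖ / ‖u_s‖ - 1 :=
          Real.log_le_sub_one_of_pos (div_pos h1 h0)
      _ = (‖u_s + ↑t‖ - ‖u_s‖) / ‖u_s‖ := by field_simp
      _ ≤ ‖(t : ℂ)‖ / ‖u_s‖ := by
          gcongr
          linarith [norm_add_le u_s (t : ℂ)]
      _ = |t| / ‖u_s‖ := by rw [Complex.norm_real, Real.norm_eq_abs]
  -- the `log ‖u² + a‖` term
  set ζ : ℂ := (t : ℂ) * (2 * u_s + t) / q with hζdef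
  have hfac : (u_s + t) ^ 2 + a = q * (1 + ζ) := by
    rw [hζdef]
    field_simp
    rw [hqdef]
    ring
  have h1ζ : 1 + ζ ≠ 0 := by
    intro h
    apply hqt
    rw [hfac, h, mul_zero]
  have hlog2 : Real.log ‖(u_s + t) ^ 2 + a‖ - Real.log ‖q‖ ≤ ζ.re + ‖ζ‖ ^ 2 / 2 := by
    have h1 : 0 < ‖1 + ζ‖ := norm_pos_iff.mpr h1ζ
    rw [hfac, norm_mul, Real.log_mul hq'.ne' h1.ne', add_sub_cancel_left]
    have h2 : Real.log ‖1 + ζ‖ = 1 / 2 * Real.log (‖1 + ζ‖ ^ 2) := by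
      rw [Real.log_pow]
      push_cast
      ring
    have h3 : Real.log (‖1 + ζ‖ ^ 2) ≤ ‖1 + ζ‖ ^ 2 - 1 := Real.log_le_sub_one_of_pos (by positivity)
    have h4 : ‖1 + ζ‖ ^ 2 = 1 + 2 * ζ.re + ‖ζ‖ ^ 2 := by
      rw [Complex.sq_norm, Complex.sq_norm, Complex.normSq_apply, Complex.normSq_apply]
      simp
      ring
    rw [h2]
    linarith [h3, h4]
  have hζre : T * ζ.re = t * ((2 * (M : ℂ) - 1) * u_s / q).re + T * (((t : ℂ) ^ 2) / q).re := by
    have e : ζ = (t : ℂ) * (((2 : ℝ) : ℂ) * (u_s / q)) + (t : ℂ) ^ 2 / q := by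
      rw [hζdef]
      push_cast
      ring
    have e2 : (2 * (M : ℂ) - 1) * u_s / q = ((2 * T : ℝ) : ℂ) * (u_s / q) := by
      rw [h2M]
      ring
    rw [e, e2, Complex.add_re, Complex.re_ofReal_mul, Complex.re_ofReal_mul, Complex.re_ofReal_mul]
    ring
  have hζ2 : T * (((t : ℂ) ^ 2) / q).re ≤ t ^ 2 * (T / ‖q‖) := by
    have h1 := (abs_le.mp (Complex.abs_re_le_norm (((t : ℂ) ^ 2) / q))).2
    rw [norm_div, norm_pow, Complex.norm_real, Real.norm_eq_abs, sq_abs] at h1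
    have h2 := mul_le_mul_of_nonneg_left h1 hT0
    calc T * (((t : ℂ) ^ 2) / q).re ≤ T * (t ^ 2 / ‖q‖) := h2
      _ = t ^ 2 * (T / ‖q‖) := by ring
  have hζn : T * (‖ζ‖ ^ 2 / 2) = t ^ 2 * ‖2 * u_s + t‖ ^ 2 * (T / (2 * ‖q‖ ^ 2)) := by
    rw [hζdef, norm_div, norm_mul, Complex.norm_real, Real.norm_eq_abs, div_pow, mul_pow, sq_abs]
    ring
  have key : T * (Real.log ‖(u_s + ↑t) ^ 2 + a‖ - Real.log ‖q‖) ≤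
      t * ((2 * (M : ℂ) - 1) * u_s / q).re + t ^ 2 * (T / ‖q‖)
        + t ^ 2 * ‖2 * u_s + t‖ ^ 2 * (T / (2 * ‖q‖ ^ 2)) := by
    have h1 := mul_le_mul_of_nonneg_left hlog2 hT0
    rw [mul_add, hζre, hζn] at h1
    linarith [hζ2]
  -- assemble
  have h9a : ((9 : ℂ) * (u_s + t)).re = 9 * u_s.re + 9 * t := by
    rw [Complex.mul_re]
    simp
    ring
  have h9b : ((9 : ℂ) * u_s).re = 9 * u_s.re := by
    rw [Complex.mul_re]
    simp
  simp only [farPsi]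
  rw [h4, ← hPc, hTC, ← hqdef]
  simp only [Complex.add_re, Complex.sub_re, Complex.re_ofReal_mul, Complex.log_re]
  rw [h9a, h9b]
  linarith [key, hlog1]

/-! ## 2. One-variable facts -/

/-- LEFT one-variable fact: for `1/30 ≤ s ≤ 213/100`,
`e^{−4s} − 1 + 4s − (9/200)s − (103/100)s² ≥ 29/10000` (`Real.exp_bound` on `[1/30, 1/4]`, `(1−s)⁴ ≤ e^{−4s}` on
`[1/4, 1]`, `e^{−4s} ≥ 0` on `[1, 213/100]`). -/
theorem descent_left_aux {s : ℝ} (hs1 : 1 / 30 ≤ s) (hs2 : s ≤ 213 / 100) :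
    29 / 10000 ≤ Real.exp (-(4 * s)) - 1 + 4 * s - 9 / 200 * s - 103 / 100 * s ^ 2 := by
  have hs0 : 0 ≤ s := by linarith
  rcases le_total s (1 / 4) with h | h
  · -- Taylor with remainder, `|x| ≤ 1`, three terms
    have hx : |(-(4 * s))| ≤ 1 := by rw [abs_le]; constructor <;> linarith
    have hb := Real.exp_bound hx (n := 3) (by norm_num)
    have hsum : ∑ m ∈ Finset.range 3, (-(4 * s)) ^ m / (m.factorial : ℝ) = 1 - 4 * s + 8 * s ^ 2 := by
      simp [Finset.sum_range_succ, Nat.factorial]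
      ring
    rw [hsum] at hb
    have habs : |(-(4 * s))| = 4 * s := by rw [abs_neg, abs_of_nonneg (by linarith)]
    rw [habs] at hb
    norm_num [Nat.factorial] at hb
    have hb' := (abs_le.mp hb).1
    rcases le_total s (1 / 10) with h' | h'
    · have c1 : s ^ 3 ≤ 1 / 10 * s ^ 2 := by nlinarith
      nlinarith [hb', c1, mul_nonneg (sub_nonneg.2 hs1) hs0]
    · have c1 : s ^ 3 ≤ 1 / 4 * s ^ 2 := by nlinarith
      nlinarith [hb', c1, mul_nonneg (sub_nonneg.2 h') hs0]
  rcases le_total s 1 with h1 | h1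
  · -- `(1 − s)⁴ ≤ e^{−4s}`
    have h0 : 0 ≤ -s + 1 := by linarith
    have he := Real.add_one_le_exp (-s)
    have h2 : (1 - s) ^ 4 ≤ Real.exp (-(4 * s)) := by
      calc (1 - s) ^ 4 = (-s + 1) ^ 4 := by ring
        _ ≤ Real.exp (-s) ^ 4 := pow_le_pow_left₀ h0 he 4
        _ = Real.exp (-(4 * s)) := by rw [← Real.exp_nat_mul]; ring_nf
    have h3 : s ^ 2 * 1 ≤ s ^ 2 * (2 - s) ^ 2 := by
      apply mul_le_mul_of_nonneg_left _ (sq_nonneg s)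
      nlinarith
    nlinarith [h2, h3, mul_nonneg (sub_nonneg.2 h) hs0]
  · have h2 : 0 ≤ Real.exp (-(4 * s)) := (Real.exp_pos _).le
    nlinarith [h2, mul_nonneg (sub_nonneg.2 h1) (sub_nonneg.2 hs2)]

/-- RIGHT one-variable fact: for `t ≥ 0`,
`e^{4t} − 1 − 4t − (9/200)t − t²/4 − (39/50)t²(1+t/18)² ≥ (697/100)t² − (9/200)t`
(`e^{4t} ≥ 1 + 4t + 8t² + (32/3)t³ + (32/3)t⁴`). -/
theorem descent_right_aux {t : ℝ} (ht : 0 ≤ t) :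
    697 / 100 * t ^ 2 - 9 / 200 * t ≤
      Real.exp (4 * t) - 1 - 4 * t - 9 / 200 * t - 1 / 4 * t ^ 2 - 39 / 50 * (t ^ 2 * (1 + t / 18) ^ 2) := by
  have h := Real.sum_le_exp_of_nonneg (show (0 : ℝ) ≤ 4 * t by positivity) 5
  have hsum : ∑ i ∈ Finset.range 5, (4 * t) ^ i / (i.factorial : ℝ) =
      1 + 4 * t + 8 * t ^ 2 + 32 / 3 * t ^ 3 + 32 / 3 * t ^ 4 := by
    simp [Finset.sum_range_succ, Nat.factorial]
    ring
  rw [hsum] at h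
  nlinarith [h, pow_nonneg ht 3, pow_nonneg ht 4]

/-! ## 3. Sizes on the line -/

/-- `‖2u + t‖² ≤ 4‖u‖²` for `t ≤ 0` and `4Re u + t ≥ 0`. -/
theorem norm_two_mul_add_sq_le_left {u : ℂ} {t : ℝ} (ht : t ≤ 0) (h : 0 ≤ 4 * u.re + t) :
    ‖2 * u + (t : ℂ)‖ ^ 2 ≤ 4 * ‖u‖ ^ 2 := by
  rw [Complex.sq_norm, Complex.sq_norm, Complex.normSq_apply, Complex.normSq_apply]
  simp [Complex.mul_re, Complex.mul_im]
  nlinarith [mul_nonneg (neg_nonneg.2 ht) h]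

/-- `‖2u + t‖² ≤ 4‖u‖²(1 + t/18)²` for `t ≥ 0` and `‖u‖ ≥ 9`. -/
theorem norm_two_mul_add_sq_le_right {u : ℂ} {t : ℝ} (ht : 0 ≤ t) (hu : 9 ≤ ‖u‖) :
    ‖2 * u + (t : ℂ)‖ ^ 2 ≤ 4 * ‖u‖ ^ 2 * (1 + t / 18) ^ 2 := by
  have e2 : ‖(2 : ℂ)‖ = 2 := by simp
  have h1 : ‖2 * u + (t : ℂ)‖ ≤ 2 * ‖u‖ * (1 + t / 18) := by
    calc ‖2 * u + (t : ℂ)‖ ≤ ‖2 * u‖ + ‖(t : ℂ)‖ := norm_add_le _ _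
      _ = 2 * ‖u‖ + t := by rw [norm_mul, e2, Complex.norm_real, Real.norm_eq_abs, abs_of_nonneg ht]
      _ ≤ 2 * ‖u‖ * (1 + t / 18) := by nlinarith [hu, ht]
  calc ‖2 * u + (t : ℂ)‖ ^ 2 ≤ (2 * ‖u‖ * (1 + t / 18)) ^ 2 := pow_le_pow_left₀ (norm_nonneg _) h1 2
    _ = 4 * ‖u‖ ^ 2 * (1 + t / 18) ^ 2 := by ring

/-- Non-vanishing along the line: for `x > υ − 2`, `|y| ≤ 1/8`, `‖a‖ ≤ (9/25)υ²`, `υ ≥ 189/20`, the points `x + iy` and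
`(x+iy)² + a` are non-zero (`Re((x+iy)² + a) ≥ x² − 1/64 − (9/25)υ² > 0`). -/
theorem line_ne_zero {υ : ℝ} (hυ0 : (189 / 20 : ℝ) ≤ υ) {a : ℂ} (ha : ‖a‖ ≤ (9 / 25 : ℝ) * υ ^ 2)
    {y : ℝ} (hy : |y| ≤ 1 / 8) {x : ℝ} (hx : υ - 2 < x) :
    (x : ℂ) + y * I ≠ 0 ∧ ((x : ℂ) + y * I) ^ 2 + a ≠ 0 := by
  have hxpos : 0 < x := by linarith
  constructor
  · intro h
    have h1 := congrArg Complex.re h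
    simp at h1
    linarith
  · intro h
    have h1 := congrArg Complex.re h
    simp [sq, Complex.mul_re, Complex.mul_im] at h1
    have ha_re : |a.re| ≤ 9 / 25 * υ ^ 2 := (Complex.abs_re_le_norm a).trans ha
    obtain ⟨ha1, ha2⟩ := abs_le.mp ha_re
    obtain ⟨hy1, hy2⟩ := abs_le.mp hy
    have hy2' : y * y ≤ 1 / 64 := by nlinarith
    have hx2 : (υ - 2) * (υ - 2) < x * x := by nlinarith
    have hυpos : 0 < υ := by linarith
    nlinarith [mul_nonneg (sub_nonneg.2 hυ0) hυpos.le]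

end Summit.RiemannHypothesis.RiemannHypothesis.Theorems.JensenPolynomials.FarGumbel

end
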